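import Summits.CriticalPhenomena.PercolationContinuityZ3.Theorems.Transplant.FKConnectivityAllQAntipodalRootForm3BaseParSat
import HarnessLib

/-!
# Connectivity correlation inequalities for `φ_{w,q}` — ROOT-FORM CALCULUS, file 73d: **GLUE(2,1)∥ — fact 1 of `E₁ ∥ B`** from the five facts + pivot
# facts of the two-special environment and the box axioms, by regrouping the kernel-checked certificate (61e pattern)

Support file (`--supports stmt-CriticalPhenomena-4575`), FK sub-lane `prim-bschramm-fk-2` (gen 31); builds on p205010 (kernel theorem, internal audit
signed; external expert review pending).  No definitions, no named facts, no sorries.  Memo FROM-fk-2-g31-DUALITY.md §6–§8 ((G3)).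
`Base3.gcombPar_gMt_nonneg`: for an abstract two-special environment `E₁ : Env C₁` and an abstract one-special box `B : C_B → BDat` with locally consistent
types, the hypotheses F1 (nested maj₃ root functional), F2sum (its parallel transform, `g`-coordinate summed), F4 (contracted AND), Ucony/Uconz (pivot A1 of
`E₁` read as a `y`-box or a `z`-box), Uexy (exact-level root-U of the `y`-box) and the box axioms A1/A3n/A4n of `B` imply that the nested three-special root
functional of `E₁ ∥ B` (`Base3.gcombPar`, file 73a) is nonnegative on monotone nested nonnegative weights — fact 1 of the parallel 2+1 base of the `T2⁺`
pipeline.  Proof: pointwise `16·(H₁·slot₁ + H₀·slot₀) = H₁(ρ₁ + e₁ + b₁) + H₀(ρ₀ + e₀ + b₀)` (slot links 73a, `Cert3.rho`), the residual part is `≥ 0` by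
`Cert3.rho_window` (72e) inside the window and vanishes outside it (saturation), and every table entry regroups — for a fixed configuration of the partner —
into ONE hypothesis instance against the weights `β ↦ H_s(β,γ)` resp. `γ ↦ H_s(β,γ)` (generator links 73b, 61e `gA1…`); bookkeeping + saturation (`rho_all`) are file 73c.
[folklore]
-/

noncomputable section

namespace Summit.CriticalPhenomena.PercolationContinuityZ3.Theorems

namespace FK

namespace RootForm

namespace Base3

open Finset Base Gen Cert3

/-! ### One table entry = one hypothesis instance -/

section Entries

variable {C₁ C_B : Type*} [Fintype C₁] [Fintype C_B] [Preorder C₁] [Preorder C_B]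

/-- weight selected by a slot bit. [folklore] -/
theorem put_pair (b : Bool) (v : ℤ) (x y : ℝ) :
    x * ((put b v).1 : ℝ) + y * ((put b v).2 : ℝ) = (if b then x else y) * (v : ℝ) := by
  cases b <;> simp [put]

/-- **E₁-side entry**: against nested monotone nonnegative weights `h0 ≤ h1`, every sane E₁-side table entry integrates to `≥ 0` by the matching
hypothesis (F1 / F2sum / F4 / Ucony / Uconz / Uexy). [folklore] -/
theorem entryE_nonneg (E₁ : Env C₁)
    (hF1 : ∀ h0 h1 : C₁ → ℝ, Monotone h0 → Monotone h1 → (∀ β, 0 ≤ h0 β) → (∀ β, h0 β ≤ h1 β) → ∀ K : ℤ, 0 ≤ Mt E₁ h0 h1 K)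
    (hF2 : ∀ h0 h1 : C₁ → ℝ, Monotone h0 → Monotone h1 → (∀ β, 0 ≤ h0 β) → (∀ β, h0 β ≤ h1 β) → ∀ K : ℤ,
      0 ≤ Mt (parE E₁) (fun p => h0 p.2) (fun p => h1 p.2) K)
    (hF4 : ∀ h : C₁ → ℝ, Monotone h → (∀ β, 0 ≤ h β) → ∀ K : ℤ, 0 ≤ ∑ β, h β * (E₁ β).andCon K)
    (hUy : ∀ h0 h1 : C₁ → ℝ, Monotone h0 → Monotone h1 → (∀ β, 0 ≤ h0 β) → (∀ β, h0 β ≤ h1 β) → ∀ K : ℤ,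
      0 ≤ ∑ β, (h0 β * ((E₁ β).d0.acon K - (E₁ β).dy.acon K) + h1 β * ((E₁ β).dz.acon K - (E₁ β).dyz.acon K)))
    (hUz : ∀ h0 h1 : C₁ → ℝ, Monotone h0 → Monotone h1 → (∀ β, 0 ≤ h0 β) → (∀ β, h0 β ≤ h1 β) → ∀ K : ℤ,
      0 ≤ ∑ β, (h0 β * ((E₁ β).d0.acon K - (E₁ β).dz.acon K) + h1 β * ((E₁ β).dy.acon K - (E₁ β).dyz.acon K)))
    (hXy : ∀ l0 h0 l1 h1 : C₁ → ℝ, Monotone l0 → Monotone h0 → Monotone l1 → Monotone h1 → (∀ β, 0 ≤ l0 β) → (∀ β, l0 β ≤ h0 β) →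
      (∀ β, l1 β ≤ h1 β) → (∀ β, l0 β ≤ l1 β) → (∀ β, h0 β ≤ h1 β) → ∀ K : ℤ,
      0 ≤ ∑ β, (h0 β * ((E₁ β).dy.r1 K - (E₁ β).dy.r2 K) + l0 β * ((E₁ β).d0.r1 K - (E₁ β).d0.r2 K)
        + h1 β * ((E₁ β).dyz.r1 K - (E₁ β).dyz.r2 K) + l1 β * ((E₁ β).dz.r1 K - (E₁ β).dz.r2 K)))
    (e : EF × ℤ × ℤ) (hok : okE e = true) (h0 h1 : C₁ → ℝ) (m0 : Monotone h0) (m1 : Monotone h1) (n0 : ∀ β, 0 ≤ h0 β) (le : ∀ β, h0 β ≤ h1 β)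
    (K : ℤ) :
    0 ≤ ∑ β, (h1 β * ((evalE e.1 (ptype (E₁ β)) (K - (E₁ β).d0.lam)).1 : ℝ) + h0 β * ((evalE e.1 (ptype (E₁ β)) (K - (E₁ β).d0.lam)).2 : ℝ)) := by
  have n1 : ∀ β, 0 ≤ h1 β := fun β => (n0 β).trans (le β)
  have hsel : ∀ b : Bool, Monotone (fun β => if b then h1 β else h0 β) ∧ (∀ β, 0 ≤ (if b then h1 β else h0 β)) := by
    intro b; cases b
    · exact ⟨m0, n0⟩
    · exact ⟨m1, n1⟩
  have hle : ∀ a b : Bool, (!(a && !b)) = true → ∀ β, (if a then h1 β else h0 β) ≤ (if b then h1 β else h0 β) := by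
    intro a b hab β; have := le β; cases a <;> cases b <;> simp_all
  obtain ⟨f, d, ν⟩ := e
  simp only [okE, Bool.and_eq_true, decide_eq_true_eq] at hok
  obtain ⟨⟨⟨_, _⟩, _⟩, hadm⟩ := hok
  cases f with
  | F1 hi lw =>
    have hw := hle lw hi (by revert hadm; cases hi <;> cases lw <;> simp)
    have key : ∀ β, h1 β * ((evalE (.F1 hi lw) (ptype (E₁ β)) (K - (E₁ β).d0.lam)).1 : ℝ) + h0 β * ((evalE (.F1 hi lw) (ptype (E₁ β)) (K - (E₁ β).d0.lam)).2 : ℝ)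
        = (if hi then h1 β else h0 β) * (E₁ β).slot1 K + (if lw then h1 β else h0 β) * (E₁ β).slot0 K := by
      intro β; rw [slot1_link, slot0_link]; simp only [evalE, add2]; push_cast
      have := put_pair hi (mv1 (ptype (E₁ β)) (K - (E₁ β).d0.lam)) (h1 β) (h0 β)
      have := put_pair lw (mv0 (ptype (E₁ β)) (K - (E₁ β).d0.lam)) (h1 β) (h0 β)
      linarith
    simp only [key]
    have := hF1 _ _ (hsel lw).1 (hsel hi).1 (hsel lw).2 hw K
    unfold Mt at this; simpa [add_comm, mul_comm] using this
  | F2sum hi lw =>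
    have hw := hle lw hi (by revert hadm; cases hi <;> cases lw <;> simp)
    have key : ∀ β, h1 β * ((evalE (.F2sum hi lw) (ptype (E₁ β)) (K - (E₁ β).d0.lam)).1 : ℝ)
        + h0 β * ((evalE (.F2sum hi lw) (ptype (E₁ β)) (K - (E₁ β).d0.lam)).2 : ℝ)
        = ((if hi then h1 β else h0 β) * (parE E₁ (true, β)).slot1 K + (if lw then h1 β else h0 β) * (parE E₁ (true, β)).slot0 K)
          + ((if hi then h1 β else h0 β) * (parE E₁ (false, β)).slot1 K + (if lw then h1 β else h0 β) * (parE E₁ (false, β)).slot0 K) := by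
      intro β
      have et : parE E₁ (true, β) = (E₁ β).par true := rfl
      have ef : parE E₁ (false, β) = (E₁ β).par false := rfl
      rw [et, ef, par_slot1_link, par_slot0_link, par_slot1_link, par_slot0_link]; simp only [evalE, add2]; push_cast
      have := put_pair hi (pv1 (ptype (E₁ β)) false (K - (E₁ β).d0.lam) + pv1 (ptype (E₁ β)) true (K - (E₁ β).d0.lam)) (h1 β) (h0 β)
      have := put_pair lw (pv0 (ptype (E₁ β)) false (K - (E₁ β).d0.lam) + pv0 (ptype (E₁ β)) true (K - (E₁ β).d0.lam)) (h1 β) (h0 β)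
      push_cast at *; linarith
    rw [Finset.sum_congr rfl fun β _ => key β]
    have := hF2 _ _ (hsel lw).1 (hsel hi).1 (hsel lw).2 hw K
    unfold Mt at this
    rw [Fintype.sum_prod_type, Finset.sum_comm] at this
    refine le_of_le_of_eq this (Finset.sum_congr rfl fun β _ => ?_)
    rw [Fintype.sum_bool]
  | F4 sl =>
    have key : ∀ β, h1 β * ((evalE (.F4 sl) (ptype (E₁ β)) (K - (E₁ β).d0.lam)).1 : ℝ) + h0 β * ((evalE (.F4 sl) (ptype (E₁ β)) (K - (E₁ β).d0.lam)).2 : ℝ)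
        = (if sl then h1 β else h0 β) * (E₁ β).andCon K := by
      intro β; rw [andCon_link]; simp only [evalE]
      exact put_pair sl _ (h1 β) (h0 β)
    simp only [key]
    exact hF4 _ (hsel sl).1 (hsel sl).2 K
  | Ucony a0 a1 =>
    have hw := hle a0 a1 hadm
    have key : ∀ β, h1 β * ((evalE (.Ucony a0 a1) (ptype (E₁ β)) (K - (E₁ β).d0.lam)).1 : ℝ)
        + h0 β * ((evalE (.Ucony a0 a1) (ptype (E₁ β)) (K - (E₁ β).d0.lam)).2 : ℝ)
        = (if a0 then h1 β else h0 β) * ((E₁ β).d0.acon K - (E₁ β).dy.acon K) + (if a1 then h1 β else h0 β) * ((E₁ β).dz.acon K - (E₁ β).dyz.acon K) := by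
      intro β
      have A0 := acon_link (E₁ β) 0 K; have A1 := acon_link (E₁ β) 1 K; have A2 := acon_link (E₁ β) 2 K; have A3 := acon_link (E₁ β) 3 K
      simp only [dq] at A0 A1 A2 A3
      rw [A0, A1, A2, A3]; simp only [evalE, add2]; push_cast
      have := put_pair a0 (con (ptype (E₁ β)) 0 (K - (E₁ β).d0.lam) - con (ptype (E₁ β)) 1 (K - (E₁ β).d0.lam)) (h1 β) (h0 β)
      have := put_pair a1 (con (ptype (E₁ β)) 2 (K - (E₁ β).d0.lam) - con (ptype (E₁ β)) 3 (K - (E₁ β).d0.lam)) (h1 β) (h0 β)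
      push_cast at *; linarith
    simp only [key]
    exact hUy _ _ (hsel a0).1 (hsel a1).1 (hsel a0).2 hw K
  | Uconz a0 a1 =>
    have hw := hle a0 a1 hadm
    have key : ∀ β, h1 β * ((evalE (.Uconz a0 a1) (ptype (E₁ β)) (K - (E₁ β).d0.lam)).1 : ℝ)
        + h0 β * ((evalE (.Uconz a0 a1) (ptype (E₁ β)) (K - (E₁ β).d0.lam)).2 : ℝ)
        = (if a0 then h1 β else h0 β) * ((E₁ β).d0.acon K - (E₁ β).dz.acon K) + (if a1 then h1 β else h0 β) * ((E₁ β).dy.acon K - (E₁ β).dyz.acon K) := by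
      intro β
      have A0 := acon_link (E₁ β) 0 K; have A1 := acon_link (E₁ β) 1 K; have A2 := acon_link (E₁ β) 2 K; have A3 := acon_link (E₁ β) 3 K
      simp only [dq] at A0 A1 A2 A3
      rw [A0, A1, A2, A3]; simp only [evalE, add2]; push_cast
      have := put_pair a0 (con (ptype (E₁ β)) 0 (K - (E₁ β).d0.lam) - con (ptype (E₁ β)) 2 (K - (E₁ β).d0.lam)) (h1 β) (h0 β)
      have := put_pair a1 (con (ptype (E₁ β)) 1 (K - (E₁ β).d0.lam) - con (ptype (E₁ β)) 3 (K - (E₁ β).d0.lam)) (h1 β) (h0 β)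
      push_cast at *; linarith
    simp only [key]
    exact hUz _ _ (hsel a0).1 (hsel a1).1 (hsel a0).2 hw K
  | Uexy g0 g1 l0 l1 =>
    simp only [Bool.and_eq_true] at hadm
    obtain ⟨⟨⟨h00, h11⟩, hll⟩, hgg⟩ := hadm
    have key : ∀ β, h1 β * ((evalE (.Uexy g0 g1 l0 l1) (ptype (E₁ β)) (K - (E₁ β).d0.lam)).1 : ℝ)
        + h0 β * ((evalE (.Uexy g0 g1 l0 l1) (ptype (E₁ β)) (K - (E₁ β).d0.lam)).2 : ℝ)
        = (if g0 then h1 β else h0 β) * ((E₁ β).dy.r1 K - (E₁ β).dy.r2 K) + (if l0 then h1 β else h0 β) * ((E₁ β).d0.r1 K - (E₁ β).d0.r2 K)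
          + (if g1 then h1 β else h0 β) * ((E₁ β).dyz.r1 K - (E₁ β).dyz.r2 K) + (if l1 then h1 β else h0 β) * ((E₁ β).dz.r1 K - (E₁ β).dz.r2 K) := by
      intro β
      have X0 := exd_link (E₁ β) 0 K; have X1 := exd_link (E₁ β) 1 K; have X2 := exd_link (E₁ β) 2 K; have X3 := exd_link (E₁ β) 3 K
      simp only [dq] at X0 X1 X2 X3
      rw [X0, X1, X2, X3]; simp only [evalE, add2]; push_cast
      have := put_pair g0 (exd (ptype (E₁ β)) 1 (K - (E₁ β).d0.lam)) (h1 β) (h0 β)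
      have := put_pair l0 (exd (ptype (E₁ β)) 0 (K - (E₁ β).d0.lam)) (h1 β) (h0 β)
      have := put_pair g1 (exd (ptype (E₁ β)) 3 (K - (E₁ β).d0.lam)) (h1 β) (h0 β)
      have := put_pair l1 (exd (ptype (E₁ β)) 2 (K - (E₁ β).d0.lam)) (h1 β) (h0 β)
      linarith
    simp only [key]
    exact hXy _ _ _ _ (hsel l0).1 (hsel g0).1 (hsel l1).1 (hsel g1).1 (hsel l0).2 (hle l0 g0 h00) (hle l1 g1 h11) (hle l0 l1 hll) (hle g0 g1 hgg) K

/-- **Box-side entry**: every sane box-side table entry integrates to `≥ 0` by A1 / A3n / A4n. [folklore] -/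
theorem entryB_nonneg (B : C_B → BDat)
    (hB1 : ∀ h : C_B → ℝ, Monotone h → (∀ γ, 0 ≤ h γ) → ∀ K : ℤ, 0 ≤ ∑ γ, h γ * gA1 (B γ) K)
    (hB3 : ∀ h0 h1 : C_B → ℝ, Monotone h0 → Monotone h1 → (∀ γ, 0 ≤ h0 γ) → (∀ γ, h0 γ ≤ h1 γ) → ∀ K : ℤ,
      0 ≤ ∑ γ, (h1 γ * gA3u (B γ) K + h0 γ * gA3l (B γ) K))
    (hB4 : ∀ h0 h1 : C_B → ℝ, Monotone h0 → Monotone h1 → (∀ γ, 0 ≤ h0 γ) → (∀ γ, h0 γ ≤ h1 γ) → ∀ K : ℤ,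
      0 ≤ ∑ γ, (h1 γ * gA4u (B γ) K + h0 γ * gA4l (B γ) K))
    (e : BF × ℤ × ℤ) (hok : okB e = true) (h0 h1 : C_B → ℝ) (m0 : Monotone h0) (m1 : Monotone h1) (n0 : ∀ γ, 0 ≤ h0 γ) (le : ∀ γ, h0 γ ≤ h1 γ)
    (K : ℤ) :
    0 ≤ ∑ γ, (h1 γ * ((evalB e.1 (B γ).type (K - (B γ).t0.L)).1 : ℝ) + h0 γ * ((evalB e.1 (B γ).type (K - (B γ).t0.L)).2 : ℝ)) := by
  have n1 : ∀ γ, 0 ≤ h1 γ := fun γ => (n0 γ).trans (le γ)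
  have hsel : ∀ b : Bool, Monotone (fun γ => if b then h1 γ else h0 γ) ∧ (∀ γ, 0 ≤ (if b then h1 γ else h0 γ)) := by
    intro b; cases b
    · exact ⟨m0, n0⟩
    · exact ⟨m1, n1⟩
  have hle : ∀ a b : Bool, (!(a && !b)) = true → ∀ γ, (if a then h1 γ else h0 γ) ≤ (if b then h1 γ else h0 γ) := by
    intro a b hab γ; have := le γ; cases a <;> cases b <;> simp_all
  obtain ⟨f, d, ν⟩ := e
  simp only [okB, Bool.and_eq_true, decide_eq_true_eq] at hok
  obtain ⟨⟨⟨_, _⟩, _⟩, hadm⟩ := hok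
  cases f with
  | A1 sl =>
    have key : ∀ γ, h1 γ * ((evalB (.A1 sl) (B γ).type (K - (B γ).t0.L)).1 : ℝ) + h0 γ * ((evalB (.A1 sl) (B γ).type (K - (B γ).t0.L)).2 : ℝ)
        = (if sl then h1 γ else h0 γ) * gA1 (B γ) K := by
      intro γ; unfold gA1; simp only [evalB]; exact put_pair sl _ (h1 γ) (h0 γ)
    simp only [key]; exact hB1 _ (hsel sl).1 (hsel sl).2 K
  | A3 hi lw =>
    have hw := hle lw hi (by revert hadm; cases hi <;> cases lw <;> simp)
    have key : ∀ γ, h1 γ * ((evalB (.A3 hi lw) (B γ).type (K - (B γ).t0.L)).1 : ℝ) + h0 γ * ((evalB (.A3 hi lw) (B γ).type (K - (B γ).t0.L)).2 : ℝ)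
        = (if hi then h1 γ else h0 γ) * gA3u (B γ) K + (if lw then h1 γ else h0 γ) * gA3l (B γ) K := by
      intro γ; unfold gA3u gA3l; simp only [evalB, add2]; push_cast
      have := put_pair hi (Cert.A3u (B γ).type (K - (B γ).t0.L)) (h1 γ) (h0 γ)
      have := put_pair lw (Cert.A3l (B γ).type (K - (B γ).t0.L)) (h1 γ) (h0 γ)
      linarith
    simp only [key]; exact hB3 _ _ (hsel lw).1 (hsel hi).1 (hsel lw).2 hw K
  | A4 hi lw =>
    have hw := hle lw hi (by revert hadm; cases hi <;> cases lw <;> simp)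
    have key : ∀ γ, h1 γ * ((evalB (.A4 hi lw) (B γ).type (K - (B γ).t0.L)).1 : ℝ) + h0 γ * ((evalB (.A4 hi lw) (B γ).type (K - (B γ).t0.L)).2 : ℝ)
        = (if hi then h1 γ else h0 γ) * gA4u (B γ) K + (if lw then h1 γ else h0 γ) * gA4l (B γ) K := by
      intro γ; unfold gA4u gA4l; simp only [evalB, add2]; push_cast
      have := put_pair hi (Cert.A4u (B γ).type (K - (B γ).t0.L)) (h1 γ) (h0 γ)
      have := put_pair lw (Cert.A4l (B γ).type (K - (B γ).t0.L)) (h1 γ) (h0 γ)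
      linarith
    simp only [key]; exact hB4 _ _ (hsel lw).1 (hsel hi).1 (hsel lw).2 hw K

end Entries

/-! ### The gluing theorem -/

section Main

variable {C₁ C_B : Type*} [Fintype C₁] [Fintype C_B] [Preorder C₁] [Preorder C_B]

/-- distributing two weights over a pair of integer list sums. [folklore] -/
theorem pair_sum_cast {X : Type*} (l : List X) (f g : X → ℤ) (x y : ℝ) :
    x * (((l.map f).sum : ℤ) : ℝ) + y * (((l.map g).sum : ℤ) : ℝ) = (l.map fun e => x * (f e : ℝ) + y * (g e : ℝ)).sum := by
  induction l with
  | nil => simp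
  | cons a l ih =>
    simp only [List.map_cons, List.sum_cons, Int.cast_add]
    rw [← ih]; ring

/-- **GLUE(2,1)∥ — fact 1 of `E₁ ∥ B`.**  For an abstract two-special environment `E₁` and an abstract one-special box `B` with locally
consistent types: the E₁ facts F1 (nested maj₃ root functional), F2sum (its parallel transform, `g` summed), F4 (contracted AND), Ucony/Uconz
(contracted pivots of `E₁` read as a `y`-box or a `z`-box) and Uexy (exact-level root-U of the `y`-box), together with the box axioms A1/A3n/A4n of `B`,
imply that the nested three-special root functional of `E₁ ∥ B` is nonnegative on monotone nested nonnegative weights — by the kernel-checked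
certificate of files 72a–72e (1 332 multipliers of fk-2 g29's LP, re-verified exactly). [folklore] -/
theorem gcombPar_gMt_nonneg (E₁ : Env C₁) (B : C_B → BDat)
    (hcE : ∀ β, consistentP (ptype (E₁ β)) = true) (hcB : ∀ γ, Cert.consistentB (B γ).type = true)
    (hF1 : ∀ h0 h1 : C₁ → ℝ, Monotone h0 → Monotone h1 → (∀ β, 0 ≤ h0 β) → (∀ β, h0 β ≤ h1 β) → ∀ K : ℤ, 0 ≤ Mt E₁ h0 h1 K)
    (hF2 : ∀ h0 h1 : C₁ → ℝ, Monotone h0 → Monotone h1 → (∀ β, 0 ≤ h0 β) → (∀ β, h0 β ≤ h1 β) → ∀ K : ℤ,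
      0 ≤ Mt (parE E₁) (fun p => h0 p.2) (fun p => h1 p.2) K)
    (hF4 : ∀ h : C₁ → ℝ, Monotone h → (∀ β, 0 ≤ h β) → ∀ K : ℤ, 0 ≤ ∑ β, h β * (E₁ β).andCon K)
    (hUy : ∀ h0 h1 : C₁ → ℝ, Monotone h0 → Monotone h1 → (∀ β, 0 ≤ h0 β) → (∀ β, h0 β ≤ h1 β) → ∀ K : ℤ,
      0 ≤ ∑ β, (h0 β * ((E₁ β).d0.acon K - (E₁ β).dy.acon K) + h1 β * ((E₁ β).dz.acon K - (E₁ β).dyz.acon K)))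
    (hUz : ∀ h0 h1 : C₁ → ℝ, Monotone h0 → Monotone h1 → (∀ β, 0 ≤ h0 β) → (∀ β, h0 β ≤ h1 β) → ∀ K : ℤ,
      0 ≤ ∑ β, (h0 β * ((E₁ β).d0.acon K - (E₁ β).dz.acon K) + h1 β * ((E₁ β).dy.acon K - (E₁ β).dyz.acon K)))
    (hXy : ∀ l0 h0 l1 h1 : C₁ → ℝ, Monotone l0 → Monotone h0 → Monotone l1 → Monotone h1 → (∀ β, 0 ≤ l0 β) → (∀ β, l0 β ≤ h0 β) →
      (∀ β, l1 β ≤ h1 β) → (∀ β, l0 β ≤ l1 β) → (∀ β, h0 β ≤ h1 β) → ∀ K : ℤ,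
      0 ≤ ∑ β, (h0 β * ((E₁ β).dy.r1 K - (E₁ β).dy.r2 K) + l0 β * ((E₁ β).d0.r1 K - (E₁ β).d0.r2 K)
        + h1 β * ((E₁ β).dyz.r1 K - (E₁ β).dyz.r2 K) + l1 β * ((E₁ β).dz.r1 K - (E₁ β).dz.r2 K)))
    (hB1 : ∀ h : C_B → ℝ, Monotone h → (∀ γ, 0 ≤ h γ) → ∀ K : ℤ, 0 ≤ ∑ γ, h γ * gA1 (B γ) K)
    (hB3 : ∀ h0 h1 : C_B → ℝ, Monotone h0 → Monotone h1 → (∀ γ, 0 ≤ h0 γ) → (∀ γ, h0 γ ≤ h1 γ) → ∀ K : ℤ,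
      0 ≤ ∑ γ, (h1 γ * gA3u (B γ) K + h0 γ * gA3l (B γ) K))
    (hB4 : ∀ h0 h1 : C_B → ℝ, Monotone h0 → Monotone h1 → (∀ γ, 0 ≤ h0 γ) → (∀ γ, h0 γ ≤ h1 γ) → ∀ K : ℤ,
      0 ≤ ∑ γ, (h1 γ * gA4u (B γ) K + h0 γ * gA4l (B γ) K))
    {H0 H1 : C₁ × C_B → ℝ} (m0 : Monotone H0) (m1 : Monotone H1) (n0 : ∀ p, 0 ≤ H0 p) (le : ∀ p, H0 p ≤ H1 p) (J : ℤ) :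
    0 ≤ gMt (gcombPar E₁ B) H0 H1 J := by
  -- pointwise: 16·(H₁ slot₁ + H₀ slot₀) = residual part + E₁ part + box part
  have dec : ∀ p : C₁ × C_B, H1 p * (gcombPar E₁ B p).gslot1 J + H0 p * (gcombPar E₁ B p).gslot0 J = (1 / 16 : ℝ) *
      ((H1 p * ((rho (ptype (E₁ p.1)) (lookupB (ptype (E₁ p.1))) (B p.2).type (lookupE (B p.2).type) (J - (E₁ p.1).d0.lam - (B p.2).t0.L)).1 : ℝ)
          + H0 p * ((rho (ptype (E₁ p.1)) (lookupB (ptype (E₁ p.1))) (B p.2).type (lookupE (B p.2).type) (J - (E₁ p.1).d0.lam - (B p.2).t0.L)).2 : ℝ))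
        + (H1 p * ((rowE (lookupE (B p.2).type) (ptype (E₁ p.1)) (J - (E₁ p.1).d0.lam - (B p.2).t0.L)).1 : ℝ)
          + H0 p * ((rowE (lookupE (B p.2).type) (ptype (E₁ p.1)) (J - (E₁ p.1).d0.lam - (B p.2).t0.L)).2 : ℝ))
        + (H1 p * ((rowB (lookupB (ptype (E₁ p.1))) (B p.2).type (J - (E₁ p.1).d0.lam - (B p.2).t0.L)).1 : ℝ)
          + H0 p * ((rowB (lookupB (ptype (E₁ p.1))) (B p.2).type (J - (E₁ p.1).d0.lam - (B p.2).t0.L)).2 : ℝ))) := by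
    intro p; rw [gslot1_link, gslot0_link]; simp only [rho]; push_cast; ring
  unfold Gen.gMt
  rw [Finset.sum_congr rfl fun p _ => dec p, ← Finset.mul_sum, Finset.sum_add_distrib, Finset.sum_add_distrib]
  refine mul_nonneg (by norm_num) (add_nonneg (add_nonneg ?_ ?_) ?_)
  · -- residual part, pointwise
    refine Finset.sum_nonneg fun p _ => ?_
    have h := rho_all _ (hcE p.1) _ (hcB p.2) (J - (E₁ p.1).d0.lam - (B p.2).t0.L)
    have h1 : (0 : ℝ) ≤ (rho (ptype (E₁ p.1)) (lookupB (ptype (E₁ p.1))) (B p.2).type (lookupE (B p.2).type) (J - (E₁ p.1).d0.lam - (B p.2).t0.L)).1 := by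
      exact_mod_cast h.1
    have h2 : (0 : ℝ) ≤ (rho (ptype (E₁ p.1)) (lookupB (ptype (E₁ p.1))) (B p.2).type (lookupE (B p.2).type) (J - (E₁ p.1).d0.lam - (B p.2).t0.L)).1
        + (rho (ptype (E₁ p.1)) (lookupB (ptype (E₁ p.1))) (B p.2).type (lookupE (B p.2).type) (J - (E₁ p.1).d0.lam - (B p.2).t0.L)).2 := by
      exact_mod_cast h.2
    nlinarith [n0 p, le p, h1, h2]
  · -- E₁ part: for each γ and each table entry of its box type, one E₁ hypothesis against `β ↦ H_s (β, γ)`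
    rw [Fintype.sum_prod_type_right]
    refine Finset.sum_nonneg fun γ _ => ?_
    have hrow : ∀ β, H1 (β, γ) * ((rowE (lookupE (B γ).type) (ptype (E₁ β)) (J - (E₁ β).d0.lam - (B γ).t0.L)).1 : ℝ)
        + H0 (β, γ) * ((rowE (lookupE (B γ).type) (ptype (E₁ β)) (J - (E₁ β).d0.lam - (B γ).t0.L)).2 : ℝ)
        = ((lookupE (B γ).type).map fun e => (e.2.2 : ℝ) * (H1 (β, γ) * ((evalE e.1 (ptype (E₁ β)) ((J - (B γ).t0.L - e.2.1) - (E₁ β).d0.lam)).1 : ℝ)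
          + H0 (β, γ) * ((evalE e.1 (ptype (E₁ β)) ((J - (B γ).t0.L - e.2.1) - (E₁ β).d0.lam)).2 : ℝ))).sum := by
      intro β
      rw [rowE_eq, pair_sum_cast]
      refine congrArg List.sum (List.map_congr_left fun e _ => ?_)
      rw [show J - (E₁ β).d0.lam - (B γ).t0.L - e.2.1 = J - (B γ).t0.L - e.2.1 - (E₁ β).d0.lam from by ring]; push_cast; ring
    rw [Finset.sum_congr rfl fun β _ => hrow β, sum_list_map_comm]
    refine list_sum_nonneg _ _ fun e he => ?_
    have hok := lookupE_ok _ (hcB γ) e he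
    have hν : (0 : ℝ) ≤ e.2.2 := by
      have := hok; simp only [okE, Bool.and_eq_true, decide_eq_true_eq] at this; exact_mod_cast this.1.2
    rw [← Finset.mul_sum]
    exact mul_nonneg hν (entryE_nonneg E₁ hF1 hF2 hF4 hUy hUz hXy e hok (fun β => H0 (β, γ)) (fun β => H1 (β, γ))
      (Base.mono_left m0 γ) (Base.mono_left m1 γ) (fun β => n0 _) (fun β => le _) _)
  · -- box part: for each β and each table entry of its pair type, one box axiom against `γ ↦ H_s (β, γ)`
    rw [Fintype.sum_prod_type]
    refine Finset.sum_nonneg fun β _ => ?_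
    have hrow : ∀ γ, H1 (β, γ) * ((rowB (lookupB (ptype (E₁ β))) (B γ).type (J - (E₁ β).d0.lam - (B γ).t0.L)).1 : ℝ)
        + H0 (β, γ) * ((rowB (lookupB (ptype (E₁ β))) (B γ).type (J - (E₁ β).d0.lam - (B γ).t0.L)).2 : ℝ)
        = ((lookupB (ptype (E₁ β))).map fun e => (e.2.2 : ℝ) * (H1 (β, γ) * ((evalB e.1 (B γ).type ((J - (E₁ β).d0.lam - e.2.1) - (B γ).t0.L)).1 : ℝ)
          + H0 (β, γ) * ((evalB e.1 (B γ).type ((J - (E₁ β).d0.lam - e.2.1) - (B γ).t0.L)).2 : ℝ))).sum := by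
      intro γ
      rw [rowB_eq, pair_sum_cast]
      refine congrArg List.sum (List.map_congr_left fun e _ => ?_)
      rw [show J - (E₁ β).d0.lam - (B γ).t0.L - e.2.1 = J - (E₁ β).d0.lam - e.2.1 - (B γ).t0.L from by ring]; push_cast; ring
    rw [Finset.sum_congr rfl fun γ _ => hrow γ, sum_list_map_comm]
    refine list_sum_nonneg _ _ fun e he => ?_
    have hok := lookupB_ok _ (hcE β) e he
    have hν : (0 : ℝ) ≤ e.2.2 := by
      have := hok; simp only [okB, Bool.and_eq_true, decide_eq_true_eq] at this; exact_mod_cast this.1.2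
    rw [← Finset.mul_sum]
    exact mul_nonneg hν (entryB_nonneg B hB1 hB3 hB4 e hok (fun γ => H0 (β, γ)) (fun γ => H1 (β, γ))
      (Base.mono_right m0 β) (Base.mono_right m1 β) (fun γ => n0 _) (fun γ => le _) _)

end Main

end Base3

end RootForm

end FK

end Summit.CriticalPhenomena.PercolationContinuityZ3.Theorems

end
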